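import Summits.QuantumFields.BalabanUV.Beta.CombHId1Letters
import Summits.QuantumFields.BalabanUV.Beta.ValueJetGeneric

/-!
# `BalabanUV.Beta.CombHId1Sandwich` — binder row D1 (OWNER an2), (J-a) dictionary, item (C2) of TID § F.10 (L2′), generic part TWO: **PERIODISATION
# COMMUTES WITH THE VALUE-FUNCTION THIRD JET** — `dper M (K ∘ V ∘ K) = K ∘ dper M V ∘ K` for a lattice-invariant decaying `K`, hence
# `dper M′ (e3OfK N K S ā) = e3OfK N K (dper M ∘ S) ā` (`M = N·M′`), and on the torus
# `perF M′ (e3OfK N K (dper M ∘ S) ā)_{(ȳ₁, inl m₁),(ȳ₂, inl m₂)} = −(perF M K · perF M (vertexOfK K N (dper M ∘ S) ā) · perF M K)_{(N•ȳ₁, inr m₁),(N•ȳ₂, inr m₂)}`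

WHY.  R-FP-57 (C2) (journal l.45819): «the dressed-down words along `col_{j+1}·h̄` ARE the level-`j` step's chain-rule vertices `vertexOfK (KInvStep Lc j) Lc
(Js j).S` along `h̄`».  On ℤ^{d+1} that word is an4's `e3OfK N K S κ′ u′ := −mmRead N (K ∘ vertexOfK K N S κ′ u′ ∘ K)` (`ValueJetGeneric` :46); the door
(leaf-05 g29's `CoarseJetOrderOneGradedComb.torus_hId₁_iff_graded_comb`) reads it on the torus as a product of torus matrices.  This file is the generic
bridge: the diagonal periodisation passes through the invariant sandwich (gan24-p3's `KernelPeriodisationFibLoc.comp_dper_left ∕ _right` BY NAME), lands on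
the vertex of the PERIODISED table family (FILE C2a `CombHId1Letters.dper_vertexOfK`), and the coarse-torus `perF` of the `mm`-read is the multiplier block of
the fine torus triple product (gan24-p3's `KernelPeriodisationFib.perF_comp` ×2 + C2a `perF_mmRead_inl_inl_eq_perF`).

CONTENT ([folklore] BY NAME over OUR typed objects; no `def`, no `def … : Prop`, nothing cited, 0 sorry): §1 `shiftK_of_translate_inv`, `comp_translate_inv`,
`exists_decays_comp`, **`dper_sandwich`**; §2 `biLoc_vertexOfK`, **`dper_e3OfK`**; §3 `vertexOfK_dper_translate_inv`, `exists_decays_vertexOfK_dper`,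
**`perF_e3OfK_inl_inl`**, `perF_vertexOfK_dper_apply` (the middle factor as the torus-column-weighted finite sum of the periodised tables `perF M (dper M (S κ u))`).
NOT HERE: the instance at the record (`K := GcombSh Lc j`, the masks `axEc`, the coarse index map `fμ`, leaf-05's graded word) — the sequel `CombHId1Torus`.

HONEST DEPENDENCY (page 1, mandatory): continuum YM on T⁴ ⇐ BetaPertH ∧ nine spine estimates (0/9 proved); BetaPertH ⇐ (D1) ∧ (D4) ∧ CAP+tail;
G-an2-4 gates asym, D1 and NE2/3/4.  HONEST FRAMING (cell contract, verbatim): «discharging `BetaPertH` makes Bałaban's UV stability UNCONDITIONAL —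
a real constructive-QFT result; it is NOT the continuum limit and NOT the Clay problem.»  ABSOLUTE RULE (cell charter, verbatim): «No internally-minted
statement may enter as a cited fact. Every hypothesis is either kernel-proved in this package or a verbatim quotation of a PUBLISHED theorem with page
reference. The manuscript(s) under audit are NOT citable for their own disputed steps — they are the thing under adjudication; programme-internal
(2001/route/tribunal) claims are never citable.»  Row D1 OWNER an2 (b2b-balaban-beta-an2) gen 42, 2026-08-22.  No existing file touched.
-/

noncomputable section

open scoped BigOperators

namespace Summit.QuantumFields.BalabanUV.Beta.CombHId1Sandwich

open Finset
open Literature.MathematicalPhysics.QuantumFieldTheory.Balaban1983to89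
open Literature.MathematicalPhysics.QuantumFieldTheory.Balaban1983to89.Beta
open B12Sec2to5 (l1 l1_nonneg)
open B4TorusKernel.MultiPeriod (translate translate_apply)
open B4Reflection242 (translate_translate)
open B4Sect5Proof (latticeConst latticeConst_nonneg)
open B6Lemma24Torus (pbox)
open ExpKernelCalculus (MKer Decays BiLoc comp shiftK comp_shiftK Zl)
open AffineAveraging (Site)
open OneStepResolventKernel (Fib LocStencil decays_mono biLoc_mono)
open OneStepKernelFamily (vertexOfK vertexFamily_vertexOfK)
open BalabanStepJetsSucc (mmRead mmRead_inl_inl decays_comp)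
open Summit.QuantumFields.BalabanUV.Beta.SpineRooted (e3OfK e3OfK_apply)
open Summit.QuantumFields.BalabanUV.Beta.FP.KernelPeriodisationFib (Idx perF perF_apply perZ perZ_apply perF_comp summable_translate_of_decays translate_eq_add)
open Summit.QuantumFields.BalabanUV.Beta.FP.KernelPeriodisationFibLoc (dper dper_apply dper_translate decays_dper comp_dper_left comp_dper_right
  shiftK_eq_translate)
open Summit.QuantumFields.BalabanUV.Beta.FP.TorusGaugeCovariancePairing (wrapPt)
open Summit.QuantumFields.BalabanUV.Beta.CombHId1Letters (dper_vertexOfK vertexOfK_dper_apply nsmul_translate perF_mmRead_inl_inl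
  perF_mmRead_inl_inl_eq_perF)

variable {d : ℕ} (M : Fin (d + 1) → ℕ) [∀ μ, NeZero (M μ)] {N : ℕ} {K : MKer (d + 1) (Fib d)}

/-! ## §1 The diagonal periodisation passes through an invariant sandwich -/

omit [∀ μ, NeZero (M μ)] in
/-- [folklore] a period-lattice-invariant kernel is fixed by the period shifts. -/
theorem shiftK_of_translate_inv {A : MKer (d + 1) (Fib d)}
    (hA : ∀ (m x z : Site (d + 1)) (a b : Fib d), A (translate M x m) (translate M z m) a b = A x z a b) (m : Site (d + 1)) :
    shiftK (fun i => (M i : ℤ) * m i) A = A := by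
  funext x z a b
  rw [shiftK_eq_translate]
  exact hA m x z a b

omit [∀ μ, NeZero (M μ)] in
/-- [folklore] the composition of two period-lattice-invariant kernels is period-lattice invariant (re-indexing only, `comp_shiftK`). -/
theorem comp_translate_inv {A B : MKer (d + 1) (Fib d)}
    (hA : ∀ (m x z : Site (d + 1)) (a b : Fib d), A (translate M x m) (translate M z m) a b = A x z a b)
    (hB : ∀ (m x z : Site (d + 1)) (a b : Fib d), B (translate M x m) (translate M z m) a b = B x z a b)
    (m x z : Site (d + 1)) (a b : Fib d) : comp A B (translate M x m) (translate M z m) a b = comp A B x z a b := by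
  have h := comp_shiftK (fun i => (M i : ℤ) * m i) A B
  rw [shiftK_of_translate_inv M hA, shiftK_of_translate_inv M hB] at h
  have h' := congrFun (congrFun (congrFun (congrFun h x) z) a) b
  rw [shiftK_eq_translate] at h'
  exact h'.symm

/-- [folklore] the composition of two decaying kernels decays (an4's `decays_comp` at the common rate, constants hidden). -/
theorem exists_decays_comp {A B : MKer (d + 1) (Fib d)} {CA α CB β : ℝ} (hA : Decays A CA α) (hα : 0 < α) (hB : Decays B CB β) (hβ : 0 < β) :
    ∃ C δ : ℝ, 0 < δ ∧ Decays (comp A B) C δ := by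
  have hCA : 0 ≤ CA := hA.nonneg (Sum.inl 0)
  have hCB : 0 ≤ CB := hB.nonneg (Sum.inl 0)
  have hδ₀ : 0 < min α β := lt_min hα hβ
  exact ⟨_, min α β / 2, half_pos hδ₀, decays_comp (decays_mono hA hCA le_rfl (min_le_left α β))
    (decays_mono hB hCB le_rfl (min_le_right α β)) (half_pos hδ₀).le (half_lt_self hδ₀)⟩

/-- [folklore] **`dper_sandwich` — THE DIAGONAL PERIODISATION PASSES THROUGH AN INVARIANT SANDWICH**: for `K` invariant under the period lattice and decaying and
`V` bi-localised, `dper M (K ∘ V ∘ K) = K ∘ dper M V ∘ K` (gan24-p3's `comp_dper_left` then `comp_dper_right`, the latter on the bi-localised `K ∘ V`). -/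
theorem dper_sandwich
    (hKinv : ∀ (m x z : Site (d + 1)) (a b : Fib d), K (translate M x m) (translate M z m) a b = K x z a b)
    {CK δK CV δV : ℝ} (hK : Decays K CK δK) (hδK : 0 < δK) {V : MKer (d + 1) (Fib d)} {p q : Site (d + 1)} (hV : BiLoc V p q CV δV) (hδV : 0 < δV) :
    dper M (comp (comp K V) K) = comp (comp K (dper M V)) K := by
  have hCK : 0 ≤ CK := hK.nonneg (Sum.inl 0)
  have hCV : 0 ≤ CV := hV.nonneg (Sum.inl 0)
  have hδ₀ : 0 < min δK δV := lt_min hδK hδV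
  have hKV := ExpKernelCalculus.biLoc_comp_decays (decays_mono hK hCK le_rfl (min_le_left δK δV)) (biLoc_mono hV hCV (min_le_right δK δV))
    (half_pos hδ₀).le (half_lt_self hδ₀)
  rw [comp_dper_left M hK hδK hKinv hV hδV, comp_dper_right M hKV (half_pos hδ₀) hK hδK hKinv]

/-! ## §2 Periodisation commutes with `e3OfK` -/

/-- [folklore] an4's chain-rule vertex is bi-localised at the coarse bond's fine image (`vertexFamily_vertexOfK` at the common rate, read at one bond). -/
theorem biLoc_vertexOfK {CK δK CS δS : ℝ} (hK : Decays K CK δK) (hδK : 0 < δK)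
    {S : Fin (d + 1) → Site (d + 1) → MKer (d + 1) (Fib d)} (hS : ∀ κ u, BiLoc (S κ u) u u CS δS) (hδS : 0 < δS)
    (μ : Fin (d + 1)) (y : Site (d + 1)) :
    BiLoc (vertexOfK K N S μ y) ((N : ℤ) • y) ((N : ℤ) • y) ((d + 1 : ℕ) * (CK * CS * Zl (d + 1) (min δK δS / 2))) (min δK δS / 2) := by
  have hCK : 0 ≤ CK := hK.nonneg (Sum.inl 0)
  have hCS : 0 ≤ CS := (hS 0 0).nonneg (Sum.inl 0)
  have hS' : LocStencil S CS (min δK δS) := fun κ u => biLoc_mono (hS κ u) hCS (min_le_right δK δS)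
  exact vertexFamily_vertexOfK (N := N) hK hCK hS' (lt_min hδK hδS) (min_le_left δK δS) μ y

/-- [folklore] **`dper_e3OfK` — PERIODISATION COMMUTES WITH THE VALUE-FUNCTION THIRD JET** (`M = N·M′`): for `K` invariant under the fine period lattice and
decaying and `S` period-covariant and bond-localised,
`dper M′ (e3OfK N K S μ y) = e3OfK N K (κ u ↦ dper M (S κ u)) μ y`
(the `mm`-read turns the coarse diagonal period sum into the fine one — `nsmul_translate` —, which passes the sandwich — `dper_sandwich` — and lands on the vertex of
the periodised family — C2a's `dper_vertexOfK`; the non-`(inl, inl)` colours vanish on both sides). -/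
theorem dper_e3OfK {M M' : Fin (d + 1) → ℕ} [∀ μ, NeZero (M μ)] [∀ μ, NeZero (M' μ)] (hM : ∀ i, M i = N * M' i)
    (hKinv : ∀ (m x z : Site (d + 1)) (a b : Fib d), K (translate M x m) (translate M z m) a b = K x z a b)
    {CK δK CS δS : ℝ} (hK : Decays K CK δK) (hδK : 0 < δK)
    {S : Fin (d + 1) → Site (d + 1) → MKer (d + 1) (Fib d)}
    (hSt : ∀ (κ : Fin (d + 1)) (u m x z : Site (d + 1)) (a b : Fib d), S κ (translate M u m) (translate M x m) (translate M z m) a b = S κ u x z a b)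
    (hS : ∀ κ u, BiLoc (S κ u) u u CS δS) (hδS : 0 < δS) (μ : Fin (d + 1)) (y : Site (d + 1)) :
    dper M' (e3OfK N K S μ y) = e3OfK N K (fun κ u => dper M (S κ u)) μ y := by
  have hCK : 0 ≤ CK := hK.nonneg (Sum.inl 0)
  have hCS : 0 ≤ CS := (hS 0 0).nonneg (Sum.inl 0)
  have hVx := biLoc_vertexOfK (N := N) hK hδK hS hδS μ y
  have hδ₀ : 0 < min δK δS / 2 := half_pos (lt_min hδK hδS)
  funext x' z' a b
  rcases a with m₁ | m₁ <;> rcases b with m₂ | m₂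
  · rw [dper_apply M' (e3OfK N K S μ y) x' z']
    simp only [e3OfK_apply, mmRead_inl_inl, nsmul_translate hM, tsum_neg]
    rw [← dper_apply M (comp (comp K (vertexOfK K N S μ y)) K) ((N : ℤ) • x') ((N : ℤ) • z') (Sum.inr m₁) (Sum.inr m₂),
      dper_sandwich M hKinv hK hδK hVx hδ₀, dper_vertexOfK M hKinv hK hCK hδK hSt hS hCS hδS]
  · simp only [dper_apply, e3OfK_apply, mmRead, neg_zero, tsum_zero]
  · simp only [dper_apply, e3OfK_apply, mmRead, neg_zero, tsum_zero]
  · simp only [dper_apply, e3OfK_apply, mmRead, neg_zero, tsum_zero]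

/-! ## §3 The torus reading: the `mm`-read periodised on the coarse torus is the multiplier block of the fine triple product -/

/-- [folklore] the vertex over the periodised family is invariant under the fine period lattice (it IS `dper M` of the lattice vertex — C2a — and `dper` is invariant). -/
theorem vertexOfK_dper_translate_inv
    (hKinv : ∀ (m x z : Site (d + 1)) (a b : Fib d), K (translate M x m) (translate M z m) a b = K x z a b)
    {CK δK CS δS : ℝ} (hK : Decays K CK δK) (hδK : 0 < δK)
    {S : Fin (d + 1) → Site (d + 1) → MKer (d + 1) (Fib d)}
    (hSt : ∀ (κ : Fin (d + 1)) (u m x z : Site (d + 1)) (a b : Fib d), S κ (translate M u m) (translate M x m) (translate M z m) a b = S κ u x z a b)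
    (hS : ∀ κ u, BiLoc (S κ u) u u CS δS) (hδS : 0 < δS) (μ : Fin (d + 1)) (y : Site (d + 1))
    (m x z : Site (d + 1)) (a b : Fib d) :
    vertexOfK K N (fun κ u => dper M (S κ u)) μ y (translate M x m) (translate M z m) a b
      = vertexOfK K N (fun κ u => dper M (S κ u)) μ y x z a b := by
  rw [← dper_vertexOfK M hKinv hK (hK.nonneg (Sum.inl 0)) hδK hSt hS ((hS 0 0).nonneg (Sum.inl 0)) hδS, dper_translate]

/-- [folklore] … and decays (it is `dper M` of a bi-localised kernel — gan24-p3's `decays_dper`). -/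
theorem exists_decays_vertexOfK_dper
    (hKinv : ∀ (m x z : Site (d + 1)) (a b : Fib d), K (translate M x m) (translate M z m) a b = K x z a b)
    {CK δK CS δS : ℝ} (hK : Decays K CK δK) (hδK : 0 < δK)
    {S : Fin (d + 1) → Site (d + 1) → MKer (d + 1) (Fib d)}
    (hSt : ∀ (κ : Fin (d + 1)) (u m x z : Site (d + 1)) (a b : Fib d), S κ (translate M u m) (translate M x m) (translate M z m) a b = S κ u x z a b)
    (hS : ∀ κ u, BiLoc (S κ u) u u CS δS) (hδS : 0 < δS) (μ : Fin (d + 1)) (y : Site (d + 1)) :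
    ∃ C δ : ℝ, 0 < δ ∧ 0 ≤ C ∧ Decays (vertexOfK K N (fun κ u => dper M (S κ u)) μ y) C δ := by
  have hCK : 0 ≤ CK := hK.nonneg (Sum.inl 0)
  have hCS : 0 ≤ CS := (hS 0 0).nonneg (Sum.inl 0)
  have hVx := biLoc_vertexOfK (N := N) hK hδK hS hδS μ y
  have hδ₀ : 0 < min δK δS / 2 := half_pos (lt_min hδK hδS)
  have hD := decays_dper M hVx (hVx.nonneg (Sum.inl 0)) hδ₀
  rw [dper_vertexOfK M hKinv hK hCK hδK hSt hS hCS hδS] at hD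
  exact ⟨_, _, half_pos hδ₀, hD.nonneg (Sum.inl 0), hD⟩

/-- [folklore] **`perF_e3OfK_inl_inl` — THE TORUS READING OF THE PERIODISED THIRD JET** (`M = N·M′`): with `S^per κ u := dper M (S κ u)` and
`V := vertexOfK K N S^per μ y`,
`perF M′ (e3OfK N K S^per μ y) ((ȳ₁, inl m₁), (ȳ₂, inl m₂)) = −(perF M K · perF M V · perF M K) ((wrapPt M (N•ȳ₁), inr m₁), (wrapPt M (N•ȳ₂), inr m₂))`
— the (ff-placed) coarse torus matrix of the `mm`-read IS minus the multiplier–multiplier entry, at the coarse points, of the product of the three fine torus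
matrices (C2a `perF_mmRead_inl_inl_eq_perF`; gan24-p3's `perF_comp` ×2 on the invariant decaying factors). -/
theorem perF_e3OfK_inl_inl {M M' : Fin (d + 1) → ℕ} [∀ μ, NeZero (M μ)] [∀ μ, NeZero (M' μ)] (hM : ∀ i, M i = N * M' i)
    (hKinv : ∀ (m x z : Site (d + 1)) (a b : Fib d), K (translate M x m) (translate M z m) a b = K x z a b)
    {CK δK CS δS : ℝ} (hK : Decays K CK δK) (hδK : 0 < δK)
    {S : Fin (d + 1) → Site (d + 1) → MKer (d + 1) (Fib d)}
    (hSt : ∀ (κ : Fin (d + 1)) (u m x z : Site (d + 1)) (a b : Fib d), S κ (translate M u m) (translate M x m) (translate M z m) a b = S κ u x z a b)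
    (hS : ∀ κ u, BiLoc (S κ u) u u CS δS) (hδS : 0 < δS) (μ : Fin (d + 1)) (y : Site (d + 1))
    (y₁ y₂ : ↥(pbox M')) (m₁ m₂ : Fin (d + 1)) :
    perF M' (e3OfK N K (fun κ u => dper M (S κ u)) μ y) (y₁, Sum.inl m₁) (y₂, Sum.inl m₂)
      = -((perF M K * perF M (vertexOfK K N (fun κ u => dper M (S κ u)) μ y) * perF M K)
          (wrapPt M ((N : ℤ) • (y₁ : Site (d + 1))), Sum.inr m₁) (wrapPt M ((N : ℤ) • (y₂ : Site (d + 1))), Sum.inr m₂)) := by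
  obtain ⟨CV, δV, hδV, -, hVd⟩ := exists_decays_vertexOfK_dper M (N := N) hKinv hK hδK hSt hS hδS μ y
  have hVinv := vertexOfK_dper_translate_inv M (N := N) hKinv hK hδK hSt hS hδS μ y
  obtain ⟨CX, δX, hδX, hKVd⟩ := exists_decays_comp hK hδK hVd hδV
  have hXinv : ∀ (m x z : Site (d + 1)) (a b : Fib d),
      comp (comp K (vertexOfK K N (fun κ u => dper M (S κ u)) μ y)) K (translate M x m) (translate M z m) a b
        = comp (comp K (vertexOfK K N (fun κ u => dper M (S κ u)) μ y)) K x z a b :=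
    comp_translate_inv M (comp_translate_inv M hKinv hVinv) hKinv
  rw [← perF_comp M hK hVd hδK hδV hVinv, ← perF_comp M hKVd hK hδX hδK hKinv, ← perF_mmRead_inl_inl_eq_perF hM hXinv, perF_apply, perF_apply,
    perZ_apply, perZ_apply, ← tsum_neg]
  refine tsum_congr fun n => ?_
  rw [e3OfK_apply]

/-- [folklore] **THE MIDDLE FACTOR AS A FINITE SUM OF THE PERIODISED TABLES' TORUS MATRICES**:
`perF M (vertexOfK K N S^per μ y) P Q = Σ_{u ∈ pbox M} Σ_κ perZ M K u (N•y) (inl κ) (inr μ) · perF M (dper M (S κ u)) P Q` (C2a `vertexOfK_dper_apply` under the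
period sum; term-wise summability from `decays_dper`). -/
theorem perF_vertexOfK_dper_apply
    (hKinv : ∀ (m x z : Site (d + 1)) (a b : Fib d), K (translate M x m) (translate M z m) a b = K x z a b)
    {CK δK CS δS : ℝ} (hK : Decays K CK δK) (hδK : 0 < δK)
    {S : Fin (d + 1) → Site (d + 1) → MKer (d + 1) (Fib d)}
    (hSt : ∀ (κ : Fin (d + 1)) (u m x z : Site (d + 1)) (a b : Fib d), S κ (translate M u m) (translate M x m) (translate M z m) a b = S κ u x z a b)
    (hS : ∀ κ u, BiLoc (S κ u) u u CS δS) (hδS : 0 < δS) (μ : Fin (d + 1)) (y : Site (d + 1)) (P Q : Idx M (Fib d)) :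
    perF M (vertexOfK K N (fun κ u => dper M (S κ u)) μ y) P Q
      = ∑ u : ↥(pbox M), ∑ κ : Fin (d + 1), perZ M K (u : Site (d + 1)) ((N : ℤ) • y) (Sum.inl κ) (Sum.inr μ) * perF M (dper M (S κ (u : Site (d + 1)))) P Q := by
  have hCK : 0 ≤ CK := hK.nonneg (Sum.inl 0)
  have hCS : 0 ≤ CS := (hS 0 0).nonneg (Sum.inl 0)
  have hM1 : ∀ i, 1 ≤ M i := fun i => Nat.one_le_iff_ne_zero.mpr (NeZero.ne (M i))
  have hsum : ∀ (u : Site (d + 1)) (κ : Fin (d + 1)), Summable fun n : Site (d + 1) => dper M (S κ u) P.1 (translate M Q.1 n) P.2 Q.2 := fun u κ => by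
    have hD := decays_dper M (hS κ u) hCS hδS
    exact summable_translate_of_decays hD (hD.nonneg (Sum.inl 0)) (half_pos hδS) hM1 _ _ _ _
  rw [perF_apply, perZ_apply]
  simp only [vertexOfK_dper_apply M hKinv hK hδK hSt hS hCS hδS]
  have h1 : ∀ u ∈ (Finset.univ : Finset ↥(pbox M)), Summable fun n : Site (d + 1) => ∑ κ : Fin (d + 1),
      perZ M K (u : Site (d + 1)) ((N : ℤ) • y) (Sum.inl κ) (Sum.inr μ) * dper M (S κ (u : Site (d + 1))) P.1 (translate M Q.1 n) P.2 Q.2 :=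
    fun u _ => summable_sum fun κ _ => (hsum (u : Site (d + 1)) κ).mul_left _
  rw [Summable.tsum_finsetSum h1]
  refine Finset.sum_congr rfl fun u _ => ?_
  have h2 : ∀ κ ∈ (Finset.univ : Finset (Fin (d + 1))), Summable fun n : Site (d + 1) =>
      perZ M K (u : Site (d + 1)) ((N : ℤ) • y) (Sum.inl κ) (Sum.inr μ) * dper M (S κ (u : Site (d + 1))) P.1 (translate M Q.1 n) P.2 Q.2 :=
    fun κ _ => (hsum (u : Site (d + 1)) κ).mul_left _
  rw [Summable.tsum_finsetSum h2]
  refine Finset.sum_congr rfl fun κ _ => ?_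
  rw [tsum_mul_left, perF_apply, perZ_apply M (dper M (S κ (u : Site (d + 1))))]

end Summit.QuantumFields.BalabanUV.Beta.CombHId1Sandwich

end
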